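import Literature.NumberTheory.LFunctions.HardyZFirstApprox
import Literature.Analysis.Fourier.VanDerCorput

/-!
# RiemannHypothesis / UniversalFactor — `NarrowKernelNoGo`, line `Sketch`, stub K1a (energy lower
bound): the Riemann–Siegel main phase under a shift, and a non-stationary oscillatory integral

Route `RiemannHypothesis/UniversalFactor`, crux `NarrowKernelNoGo` (stmt-RiemannHypothesis-2576), stub
`UniversalFactor.stub_narrowEnergyLower` (lead). With `φ(τ) = (τ/2) log(τ/2π) − τ/2 − π/8` (so that the
tree's `TwistedMoment.thetaMainPhase τ = e^{iφ(τ)}` is the main term of `e^{iϑ(τ)}`):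

* `UniversalFactor.narrowPhase_hasDerivAt` — `φ'(τ) = ½ log(τ/2π)` (`τ > 0`);
* `UniversalFactor.narrowPhase_shift_sub_linear_le` — on a block `T' ≤ t ≤ T' + U`, `|u| ≤ T'/2`:
  `|φ(t+u) − φ(t) − u·½log(T'/2π)| ≤ |u|(U + |u|)/T'` (mean value theorem twice);
* `UniversalFactor.norm_cexp_I_sub_cexp_I_le` — `‖e^{ix} − e^{iy}‖ ≤ |x − y|`;
* `UniversalFactor.thetaMainPhase_shift_mul_conj`, `…_mul` — `E₁(t+u) conj(E₁ t) = e^{i(φ(t+u)−φ(t))}`,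
  `E₁(t+u) E₁(t) = e^{i(φ(t+u)+φ(t))}`;
* `UniversalFactor.norm_integral_termB_phase_le` — the NON-STATIONARY cross term: for `2πμ² ≤ T' + u`,
  `8πν² ≤ T'`, `−T'/2 ≤ u`: `‖∫_{T'}^{T'+U} e^{i(t log(μν) − φ(t+u) − φ(t))} dt‖ ≤ 2/log 2`
  (van der Corput's first-derivative test, tree `norm_integral_exp_I_mul_le_of_deriv_ge`: the phase
  has derivative `≤ −log 2` and monotone derivative).

References: Titchmarsh (1986) §4.17, §7.3–7.4; Literature/Analysis/Fourier/VanDerCorput.lean.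
-/

noncomputable section

-- D-0017: `Summit.<S>.<S>.…` is the designed namespace of a single-problem summit.
set_option linter.dupNamespace false

namespace Summit.RiemannHypothesis.RiemannHypothesis.Theorems

open MeasureTheory Set Filter Complex intervalIntegral
open scoped Real Topology ComplexConjugate
open Literature.NumberTheory.LFunctions Literature.NumberTheory.LFunctions.TwistedMoment
open Literature.Analysis.Fourier

/-! ## The main phase `φ(τ) = (τ/2) log(τ/2π) − τ/2 − π/8` -/

/-- `φ'(τ) = ½ log(τ/2π)` for `τ > 0`. [cite: Titchmarsh1986, §4.17] -/
theorem UniversalFactor.narrowPhase_hasDerivAt {τ : ℝ} (hτ : 0 < τ) :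
    HasDerivAt (fun x : ℝ => x / 2 * Real.log (x / (2 * π)) - x / 2 - π / 8)
      (Real.log (τ / (2 * π)) / 2) τ := by
  have h2π : (0 : ℝ) < 2 * π := by positivity
  have hlog : HasDerivAt (fun x : ℝ => Real.log (x / (2 * π))) (1 / τ) τ := by
    have h1 : HasDerivAt (fun x : ℝ => x / (2 * π)) (1 / (2 * π)) τ := by
      simpa using (hasDerivAt_id τ).div_const (2 * π)
    have h2 := h1.log (by positivity : τ / (2 * π) ≠ 0)
    convert h2 using 1
    field_simp
  have hx2 : HasDerivAt (fun x : ℝ => x / 2) (1 / 2) τ := by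
    simpa using (hasDerivAt_id τ).div_const 2
  have hprod := hx2.mul hlog
  have hall := (hprod.sub hx2).sub_const (π / 8)
  have hval : 1 / 2 * Real.log (τ / (2 * π)) + τ / 2 * (1 / τ) - 1 / 2 = Real.log (τ / (2 * π)) / 2 := by
    have : τ / 2 * (1 / τ) = 1 / 2 := by field_simp
    rw [this]; ring
  rw [hval] at hall
  exact hall

/-- `φ'` is monotone: `½ log(s/2π) ≤ ½ log(t/2π)` for `0 < s ≤ t`, with the Lipschitz bound
`½ log(t/2π) − ½ log(s/2π) ≤ (t − s)/(2s)`. [folklore] -/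
theorem UniversalFactor.narrowPhase_deriv_sub_le {s t : ℝ} (hs : 0 < s) (hst : s ≤ t) :
    0 ≤ Real.log (t / (2 * π)) / 2 - Real.log (s / (2 * π)) / 2 ∧
      Real.log (t / (2 * π)) / 2 - Real.log (s / (2 * π)) / 2 ≤ (t - s) / (2 * s) := by
  have h2π : (0 : ℝ) < 2 * π := by positivity
  have ht : 0 < t := lt_of_lt_of_le hs hst
  have hdiff : Real.log (t / (2 * π)) - Real.log (s / (2 * π)) = Real.log (t / s) := by
    rw [← Real.log_div (by positivity) (by positivity)]
    congr 1
    field_simp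
  have hts : 1 ≤ t / s := by rwa [le_div_iff₀ hs, one_mul]
  constructor
  · have : 0 ≤ Real.log (t / s) := Real.log_nonneg hts
    linarith
  · have h1 : Real.log (t / s) ≤ t / s - 1 := Real.log_le_sub_one_of_pos (by positivity)
    have h2 : t / s - 1 = (t - s) / s := by field_simp
    rw [h2] at h1
    have h3 : (t - s) / (2 * s) = ((t - s) / s) / 2 := by field_simp
    rw [h3]
    linarith

/-- **Linearisation of the phase under a shift.** For `T' > 0`, `T' ≤ t ≤ T' + U`, `|u| ≤ T'/2`:
`|φ(t+u) − φ(t) − u · ½ log(T'/2π)| ≤ |u| (U + |u|)/T'`. [folklore] -/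
theorem UniversalFactor.narrowPhase_shift_sub_linear_le {T' U t u : ℝ} (hT' : 0 < T') (hU : 0 ≤ U)
    (ht : T' ≤ t) (htU : t ≤ T' + U) (hu : |u| ≤ T' / 2) :
    |(t + u) / 2 * Real.log ((t + u) / (2 * π)) - (t + u) / 2 - π / 8 -
        (t / 2 * Real.log (t / (2 * π)) - t / 2 - π / 8) - u * (Real.log (T' / (2 * π)) / 2)| ≤
      |u| * (U + |u|) / T' := by
  set φ : ℝ → ℝ := fun x => x / 2 * Real.log (x / (2 * π)) - x / 2 - π / 8 with hφ
  set φ' : ℝ → ℝ := fun x => Real.log (x / (2 * π)) / 2 with hφ'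
  have habs := abs_le.1 hu
  have hlo : T' / 2 ≤ t + u := by linarith [neg_abs_le u]
  have hlo' : 0 < T' / 2 := by linarith
  -- every point between `t` and `t + u` is `≥ T'/2 > 0`
  have hpos : ∀ x ∈ uIcc t (t + u), T' / 2 ≤ x := by
    intro x hx
    rcases le_total t (t + u) with h | h
    · rw [uIcc_of_le h] at hx; linarith [hx.1]
    · rw [uIcc_of_ge h] at hx; linarith [hx.1]
  have hderiv : ∀ x ∈ uIcc t (t + u), HasDerivAt φ (φ' x) x := fun x hx =>
    UniversalFactor.narrowPhase_hasDerivAt (lt_of_lt_of_le hlo' (hpos x hx))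
  -- mean value theorem in the form `φ(t+u) − φ(t) = u φ'(ξ)`
  obtain ⟨ξ, hξ, hξeq⟩ : ∃ ξ ∈ uIcc t (t + u), φ (t + u) - φ t = u * φ' ξ := by
    rcases lt_trichotomy u 0 with hneg | hzero | hposu
    · have hlt : t + u < t := by linarith
      obtain ⟨ξ, hξ, hξeq⟩ := exists_hasDerivAt_eq_slope φ φ' hlt
        (fun x hx => (hderiv x (by rw [uIcc_of_ge hlt.le]; exact hx)).continuousAt.continuousWithinAt)
        (fun x hx => hderiv x (by rw [uIcc_of_ge hlt.le]; exact Ioo_subset_Icc_self hx))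
      refine ⟨ξ, by rw [uIcc_of_ge hlt.le]; exact Ioo_subset_Icc_self hξ, ?_⟩
      have hne : t - (t + u) ≠ 0 := by linarith
      rw [eq_div_iff hne] at hξeq
      linarith
    · refine ⟨t, left_mem_uIcc, ?_⟩
      rw [hzero]; simp
    · have hlt : t < t + u := by linarith
      obtain ⟨ξ, hξ, hξeq⟩ := exists_hasDerivAt_eq_slope φ φ' hlt
        (fun x hx => (hderiv x (by rw [uIcc_of_le hlt.le]; exact hx)).continuousAt.continuousWithinAt)
        (fun x hx => hderiv x (by rw [uIcc_of_le hlt.le]; exact Ioo_subset_Icc_self hx))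
      refine ⟨ξ, by rw [uIcc_of_le hlt.le]; exact Ioo_subset_Icc_self hξ, ?_⟩
      have hne : t + u - t ≠ 0 := by linarith
      rw [eq_div_iff hne] at hξeq
      linarith
  have hξlo : T' / 2 ≤ ξ := hpos ξ hξ
  have hξpos : 0 < ξ := lt_of_lt_of_le hlo' hξlo
  -- `|φ'(ξ) − φ'(T')| ≤ (U + |u|)/T'`
  have hkey : |φ' ξ - φ' T'| ≤ (U + |u|) / T' := by
    rcases le_total T' ξ with h | h
    · -- `ξ ≥ T'`: `0 ≤ φ'(ξ) − φ'(T') ≤ (ξ − T')/(2T') ≤ (U + |u|)/T'`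
      obtain ⟨h0, h1⟩ := UniversalFactor.narrowPhase_deriv_sub_le hT' h
      have hξup : ξ ≤ T' + U + |u| := by
        rcases le_total t (t + u) with h' | h'
        · rw [uIcc_of_le h'] at hξ; linarith [hξ.2, le_abs_self u, htU]
        · rw [uIcc_of_ge h'] at hξ; linarith [hξ.2, abs_nonneg u, htU]
      rw [abs_of_nonneg h0]
      calc φ' ξ - φ' T' ≤ (ξ - T') / (2 * T') := h1
        _ ≤ (U + |u|) / T' := by
            rw [div_le_div_iff₀ (by positivity) hT']
            nlinarith [abs_nonneg u]
    · -- `ξ ≤ T'`: `0 ≤ φ'(T') − φ'(ξ) ≤ (T' − ξ)/(2ξ) ≤ |u|/T'`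
      obtain ⟨h0, h1⟩ := UniversalFactor.narrowPhase_deriv_sub_le hξpos h
      have hξdn : T' - ξ ≤ |u| := by
        rcases le_total t (t + u) with h' | h'
        · rw [uIcc_of_le h'] at hξ; linarith [hξ.1, abs_nonneg u, ht]
        · rw [uIcc_of_ge h'] at hξ; linarith [hξ.1, neg_abs_le u, ht]
      rw [abs_sub_comm, abs_of_nonneg h0]
      calc φ' T' - φ' ξ ≤ (T' - ξ) / (2 * ξ) := h1
        _ ≤ (U + |u|) / T' := by
            rw [div_le_div_iff₀ (by positivity) hT']
            have : (T' - ξ) * T' ≤ |u| * T' := mul_le_mul_of_nonneg_right hξdn hT'.le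
            nlinarith [abs_nonneg u]
  -- conclude
  have hmain : φ (t + u) - φ t - u * φ' T' = u * (φ' ξ - φ' T') := by rw [hξeq]; ring
  have : |φ (t + u) - φ t - u * φ' T'| ≤ |u| * (U + |u|) / T' := by
    rw [hmain, abs_mul, mul_div_assoc]
    exact mul_le_mul_of_nonneg_left hkey (abs_nonneg u)
  simpa only [hφ, hφ'] using this

/-! ## Exponentials of phases -/

/-- `‖e^{ix} − e^{iy}‖ ≤ |x − y|` for real `x, y`. [folklore] -/
theorem UniversalFactor.norm_cexp_I_sub_cexp_I_le (x y : ℝ) :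
    ‖cexp (I * x) - cexp (I * y)‖ ≤ |x - y| := by
  have h1 : cexp (I * x) - cexp (I * y) = cexp (I * y) * (cexp (I * ((x - y : ℝ) : ℂ)) - 1) := by
    rw [mul_sub, mul_one, ← Complex.exp_add]
    congr 1
    push_cast
    ring
  rw [h1, norm_mul, show I * (y : ℂ) = (y : ℂ) * I by ring, Complex.norm_exp_ofReal_mul_I, one_mul,
    norm_cexp_I_mul_sub_one]
  calc 2 * |Real.sin ((x - y) / 2)| ≤ 2 * |(x - y) / 2| :=
        mul_le_mul_of_nonneg_left Real.abs_sin_le_abs (by norm_num)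
    _ = |x - y| := by rw [abs_div, abs_two]; ring

/-- `E₁(τ) = e^{iφ(τ)}` with the phase written out. [cite: Titchmarsh1986, §9.20] -/
theorem UniversalFactor.thetaMainPhase_eq_cexp (τ : ℝ) :
    thetaMainPhase τ = cexp (I * ((τ / 2 * Real.log (τ / (2 * π)) - τ / 2 - π / 8 : ℝ) : ℂ)) :=
  thetaMainPhase_def τ

/-- `E₁(t+u) · conj(E₁(t)) = e^{i(φ(t+u) − φ(t))}`. [folklore] -/
theorem UniversalFactor.thetaMainPhase_shift_mul_conj (t u : ℝ) :
    thetaMainPhase (t + u) * conj (thetaMainPhase t) =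
      cexp (I * (((t + u) / 2 * Real.log ((t + u) / (2 * π)) - (t + u) / 2 - π / 8 -
        (t / 2 * Real.log (t / (2 * π)) - t / 2 - π / 8) : ℝ) : ℂ)) := by
  rw [thetaMainPhase_def, thetaMainPhase_def, ← Complex.exp_conj, ← Complex.exp_add]
  congr 1
  simp only [map_mul, Complex.conj_I, Complex.conj_ofReal]
  push_cast
  ring

/-- `E₁(t+u) · E₁(t) = e^{i(φ(t+u) + φ(t))}`. [folklore] -/
theorem UniversalFactor.thetaMainPhase_shift_mul (t u : ℝ) :
    thetaMainPhase (t + u) * thetaMainPhase t =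
      cexp (I * (((t + u) / 2 * Real.log ((t + u) / (2 * π)) - (t + u) / 2 - π / 8 +
        (t / 2 * Real.log (t / (2 * π)) - t / 2 - π / 8) : ℝ) : ℂ)) := by
  rw [thetaMainPhase_def, thetaMainPhase_def, ← Complex.exp_add]
  congr 1
  push_cast
  ring

/-! ## The non-stationary cross term (van der Corput) -/

/-- **The cross-term phase has no stationary point.** For `T' > 0`, `U ≥ 0`, `−T'/2 ≤ u`, naturals
`μ, ν ≥ 1` with `2πμ² ≤ T' + u` and `8πν² ≤ T'`:
`‖∫_{T'}^{T'+U} e^{i(t(log μ + log ν) − φ(t+u) − φ(t))} dt‖ ≤ 2/log 2`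
(the derivative of the negated phase is `½log((t+u)/2π) + ½log(t/2π) − log μ − log ν ≥ log 2` and is
increasing). [cite: Titchmarsh1986, §4.17 (first-derivative test)] -/
theorem UniversalFactor.norm_integral_termB_phase_le {T' U u : ℝ} {μ ν : ℕ} (hT' : 0 < T') (hU : 0 ≤ U)
    (hu : -(T' / 2) ≤ u) (hμ : 1 ≤ μ) (hν : 1 ≤ ν) (hμT : 2 * π * (μ : ℝ) ^ 2 ≤ T' + u)
    (hνT : 8 * π * (ν : ℝ) ^ 2 ≤ T') :
    ‖∫ t in T'..(T' + U), cexp (I * ((t * (Real.log μ + Real.log ν) -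
        ((t + u) / 2 * Real.log ((t + u) / (2 * π)) - (t + u) / 2 - π / 8) -
        (t / 2 * Real.log (t / (2 * π)) - t / 2 - π / 8) : ℝ) : ℂ))‖ ≤ 2 / Real.log 2 := by
  have h2π : (0 : ℝ) < 2 * π := by positivity
  have hμR : (1 : ℝ) ≤ μ := by exact_mod_cast hμ
  have hνR : (1 : ℝ) ≤ ν := by exact_mod_cast hν
  -- the negated phase `Ψ`, its derivatives
  set Ψ : ℝ → ℝ := fun t => ((t + u) / 2 * Real.log ((t + u) / (2 * π)) - (t + u) / 2 - π / 8) +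
      (t / 2 * Real.log (t / (2 * π)) - t / 2 - π / 8) - t * (Real.log μ + Real.log ν) with hΨ
  set Ψ' : ℝ → ℝ := fun t => Real.log ((t + u) / (2 * π)) / 2 + Real.log (t / (2 * π)) / 2 -
      (Real.log μ + Real.log ν) with hΨ'
  set Ψ'' : ℝ → ℝ := fun t => 1 / (2 * (t + u)) + 1 / (2 * t) with hΨ''
  have hpos_t : ∀ t ∈ Icc T' (T' + U), 0 < t := fun t ht => lt_of_lt_of_le hT' ht.1
  have hpos_tu : ∀ t ∈ Icc T' (T' + U), 0 < t + u := fun t ht => by linarith [ht.1]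
  have hderiv : ∀ t ∈ Icc T' (T' + U), HasDerivAt Ψ (Ψ' t) t := by
    intro t ht
    have h1 : HasDerivAt (fun x : ℝ => (x + u) / 2 * Real.log ((x + u) / (2 * π)) - (x + u) / 2 - π / 8)
        (Real.log ((t + u) / (2 * π)) / 2) t := by
      have h := UniversalFactor.narrowPhase_hasDerivAt (hpos_tu t ht)
      have hid : HasDerivAt (fun x : ℝ => x + u) 1 t := (hasDerivAt_id t).add_const u
      have := h.comp t hid
      simpa [Function.comp_def] using this
    have h2 := UniversalFactor.narrowPhase_hasDerivAt (hpos_t t ht)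
    have h3 : HasDerivAt (fun x : ℝ => x * (Real.log μ + Real.log ν)) (Real.log μ + Real.log ν) t := by
      simpa using (hasDerivAt_id t).mul_const (Real.log μ + Real.log ν)
    exact (h1.add h2).sub h3
  have hderiv' : ∀ t ∈ Icc T' (T' + U), HasDerivAt Ψ' (Ψ'' t) t := by
    intro t ht
    have ht0 := hpos_t t ht
    have htu0 := hpos_tu t ht
    have h1 : HasDerivAt (fun x : ℝ => Real.log ((x + u) / (2 * π)) / 2) (1 / (2 * (t + u))) t := by
      have ha : HasDerivAt (fun x : ℝ => (x + u) / (2 * π)) (1 / (2 * π)) t := by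
        simpa using ((hasDerivAt_id t).add_const u).div_const (2 * π)
      have hb := (ha.log (by positivity : (t + u) / (2 * π) ≠ 0)).div_const 2
      refine hb.congr_deriv ?_
      rw [div_div_div_cancel_right₀ (by positivity : (2 * π : ℝ) ≠ 0), div_div]
      ring
    have h2 : HasDerivAt (fun x : ℝ => Real.log (x / (2 * π)) / 2) (1 / (2 * t)) t := by
      have ha : HasDerivAt (fun x : ℝ => x / (2 * π)) (1 / (2 * π)) t := by
        simpa using (hasDerivAt_id t).div_const (2 * π)
      have hb := (ha.log (by positivity : t / (2 * π) ≠ 0)).div_const 2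
      refine hb.congr_deriv ?_
      rw [div_div_div_cancel_right₀ (by positivity : (2 * π : ℝ) ≠ 0), div_div]
      ring
    exact (h1.add h2).sub_const (Real.log μ + Real.log ν)
  have hcont'' : ContinuousOn Ψ'' (Icc T' (T' + U)) := by
    intro t ht
    have ht0 := hpos_t t ht
    have htu0 := hpos_tu t ht
    have h1 : ContinuousAt (fun x : ℝ => 1 / (2 * (x + u))) t :=
      continuousAt_const.div (by fun_prop) (by positivity)
    have h2 : ContinuousAt (fun x : ℝ => 1 / (2 * x)) t :=
      continuousAt_const.div (by fun_prop) (by positivity)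
    exact (h1.add h2).continuousWithinAt
  have hsign : (∀ t ∈ Icc T' (T' + U), 0 ≤ Ψ'' t) ∨ (∀ t ∈ Icc T' (T' + U), Ψ'' t ≤ 0) := by
    left
    intro t ht
    have ht0 := hpos_t t ht
    have htu0 := hpos_tu t ht
    simp only [hΨ'']
    positivity
  have hge : ∀ t ∈ Icc T' (T' + U), Real.log 2 ≤ Ψ' t := by
    intro t ht
    have ht0 := hpos_t t ht
    have htu0 := hpos_tu t ht
    -- `log μ ≤ ½ log((t+u)/2π)` and `log ν + log 2 ≤ ½ log(t/2π)`
    have h1 : Real.log μ ≤ Real.log ((t + u) / (2 * π)) / 2 := by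
      have hsq : (μ : ℝ) ^ 2 ≤ (t + u) / (2 * π) := by
        rw [le_div_iff₀ h2π]; nlinarith [ht.1]
      have := Real.log_le_log (by positivity) hsq
      rw [Real.log_pow] at this
      push_cast at this
      linarith
    have h2 : Real.log ν + Real.log 2 ≤ Real.log (t / (2 * π)) / 2 := by
      have hsq : (2 * (ν : ℝ)) ^ 2 ≤ t / (2 * π) := by
        rw [le_div_iff₀ h2π]; nlinarith [ht.1]
      have := Real.log_le_log (by positivity) hsq
      rw [Real.log_pow, Real.log_mul (by norm_num) (by positivity)] at this
      push_cast at this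
      linarith
    simp only [hΨ']
    linarith
  have hvdc := norm_integral_exp_I_mul_le_of_deriv_ge (φ := Ψ) (φ' := Ψ') (φ'' := Ψ'')
    (a := T') (b := T' + U) (lam := Real.log 2) (by linarith) (Real.log_pos (by norm_num))
    hderiv hderiv' hcont'' hsign hge
  -- our integral is the conjugate of `∫ e^{iΨ}`
  have hconj : (∫ t in T'..(T' + U), cexp (I * ((t * (Real.log μ + Real.log ν) -
        ((t + u) / 2 * Real.log ((t + u) / (2 * π)) - (t + u) / 2 - π / 8) -
        (t / 2 * Real.log (t / (2 * π)) - t / 2 - π / 8) : ℝ) : ℂ))) =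
      conj (∫ t in T'..(T' + U), cexp (I * Ψ t)) := by
    have hle : T' ≤ T' + U := by linarith
    rw [intervalIntegral.integral_of_le hle, intervalIntegral.integral_of_le hle, ← integral_conj]
    refine setIntegral_congr_fun measurableSet_Ioc fun t _ => ?_
    rw [← Complex.exp_conj]
    congr 1
    simp only [map_mul, Complex.conj_I, Complex.conj_ofReal, hΨ]
    push_cast
    ring
  rw [hconj, Complex.norm_conj]
  exact hvdc

/-- **Registered sub-stub `narrowTermB_vdC`** (verbatim signature): the non-stationary cross-term bound
`‖∫_{T'}^{T'+U} e^{i(t log(μν) − φ(t+u) − φ(t))} dt‖ ≤ 2/log 2`. [folklore] -/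
theorem UniversalFactor.narrowTermB_vdC : ∀ {T' U u : ℝ} {μ ν : ℕ}, 0 < T' → 0 ≤ U → -(T' / 2) ≤ u → 1 ≤ μ → 1 ≤ ν → 2 * Real.pi * (μ : ℝ) ^ 2 ≤ T' + u → 8 * Real.pi * (ν : ℝ) ^ 2 ≤ T' → ‖∫ t in T'..(T' + U), Complex.exp (Complex.I * ((t * (Real.log μ + Real.log ν) - ((t + u) / 2 * Real.log ((t + u) / (2 * Real.pi)) - (t + u) / 2 - Real.pi / 8) - (t / 2 * Real.log (t / (2 * Real.pi)) - t / 2 - Real.pi / 8) : ℝ) : ℂ))‖ ≤ 2 / Real.log 2 :=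
  fun hT' hU hu hμ hν hμT hνT => UniversalFactor.norm_integral_termB_phase_le hT' hU hu hμ hν hμT hνT

end Summit.RiemannHypothesis.RiemannHypothesis.Theorems
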